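import Mathlib
import Literature.NumberTheory.Transcendental.DrinfeldAssociatorRegularisation
import Literature.NumberTheory.Transcendental.DrinfeldAssociatorLimit
import Literature.NumberTheory.Transcendental.DrinfeldAssociatorHolonomy
import Literature.NumberTheory.Transcendental.DrinfeldAssociator

/-!
# The Drinfeld associator as a regularised transport along an edge

Support file for the proof of the pentagon equation for `Φ_KZ = drinfeldAssociator`
(`DrinfeldAssociator.lean`), step "edge estimate".

Let `α` be a finite alphabet with two distinguished letters `x ≠ y`, and let
`f : α → ℝ → ℝ` be densities on `(0,1)` with `f x = dt/t`, `f y = dt/(t-1)` and all other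
("neutral") letters small in `L¹(a,b)`.  For the transport series `S = S_{a,b}` of the
connection `Σ_c f_c(t) c dt` (`transportSeries f a b`, Chen's iterated integrals) we prove:

* `edge_factorisation`: `exp(-S(y) y) · S · exp(-S(x) x) = (W ↦ ⟨S, reg_{x,y} W⟩)`, the
  coefficientwise form of the factorisation `S = exp(S(y) y) R exp(S(x) x)` with `R` the
  `(x,y)`-regularised series (`Shuffle.factorisation`);
* `abs_pair_reg_map_sub_drinfeldAssociator_le`: on words in `x, y` only, the regularised
  series is close to `Φ_KZ`: `|R(ι w) - Φ_KZ(w)| ≤ ‖reg w‖₁ (|w|+1)² 16^{|w|} ρ_{|w|}(a,b)` where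
  `ρ_n(a,b) = (|log a|+2)^n a + (|log(1-b)|+2)^n (1-b)` (`KZ3.rate`), from the rate estimate
  `KZ3.abs_iterInt_sub_multipleZeta_le` for convergent words;
* `abs_pair_reg_le_of_neutral`: on words containing a neutral letter,
  `|R(W)| ≤ ‖reg W‖₁ η (|log a| + |log(1-b)| + η)^{|W|-1}` with `η` the `L¹` bound of the neutral
  densities.

On the way: naturality of `reg` under injective changes of alphabet (`Shuffle.reg_map`),
support properties of `reg` (letter counts and lengths are preserved), and the explicit
single-letter coefficients `S(x) = log(b/a)`, `S(y) = log((1-b)/(1-a))`.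

## References
* H. Furusho, *The multiple zeta value algebra and the stable derivation algebra*,
  Publ. RIMS 39 (2003), §3.2 (the KZ equation on three points and `Φ_KZ`). [Furusho2003]
* K. Ihara, M. Kaneko, D. Zagier, *Derivation and double shuffle relations for multiple zeta
  values*, Compos. Math. 142 (2006), §1 (regularisation `reg`). [IharaKanekoZagier2006]
* V. G. Drinfeld, *On quasitriangular quasi-Hopf algebras and on a group that is closely
  connected with Gal(Q̄/Q)*, Leningrad Math. J. 2 (1991), §2. [Drinfeld1991]
-/

noncomputable section

open MeasureTheory intervalIntegral Set Filter Finsupp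
open scoped BigOperators Topology

namespace Literature.NumberTheory.Transcendental

namespace Shuffle

universe u v
variable {α : Type u} {β : Type v}

/-! ## 1. Naturality of the regularisation under injective changes of alphabet -/

/-- Shuffles commute with letterwise maps: `φ(u) ш φ(v) = φ_*(u ш v)` (as lists). [folklore] -/
theorem shuffleWord_map (φ : α → β) :
    ∀ (u v : List α), MZV.shuffleWord (u.map φ) (v.map φ) = (MZV.shuffleWord u v).map (List.map φ)
  | [], v => by simp
  | a :: u, [] => by simp
  | a :: u, b :: v => by
    rw [List.map_cons, List.map_cons, MZV.shuffleWord_cons_cons, MZV.shuffleWord_cons_cons,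
      ← List.map_cons, ← List.map_cons, shuffleWord_map φ u (b :: v), shuffleWord_map φ (a :: u) v]
    simp [List.map_append, List.map_map, Function.comp_def]

/-- Shuffle products commute with letterwise maps: `φ(u) ш φ(v) = φ_*(u ш v)` in `ℚ⟨β⟩`.
[folklore] -/
theorem shuffleSum_map (φ : α → β) (u v : List α) :
    shuffleSum (u.map φ) (v.map φ) = (shuffleSum u v).mapDomain (List.map φ) := by
  rw [shuffleSum, shuffleWord_map, shuffleSum, wordSum_map]; rfl

variable [DecidableEq α] [DecidableEq β]

/-- The number of leading `y`'s is invariant under an injective change of alphabet. [folklore] -/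
theorem leadCount_map {φ : α → β} (hφ : Function.Injective φ) (y : α) (w : List α) :
    leadCount (φ y) (w.map φ) = leadCount y w := by
  unfold leadCount
  rw [List.takeWhile_map, List.length_map]
  congr 2
  funext b
  simp [hφ.eq_iff]

/-- `reg^{φ y}(φ w) = φ_* reg^y(w)` for an injective change of alphabet `φ`. [folklore] -/
theorem regFront_map {φ : α → β} (hφ : Function.Injective φ) (y : α) (w : List α) :
    regFront (φ y) (w.map φ) = (regFront y w).mapDomain (List.map φ) := by
  unfold regFront
  rw [leadCount_map hφ, Finsupp.mapDomain_finsetSum]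
  refine Finset.sum_congr rfl fun i _ => ?_
  rw [Finsupp.mapDomain_smul, ← shuffleSum_map, List.map_replicate, List.map_drop]

/-- `reg_{φ x}(φ w) = φ_* reg_x(w)` for an injective change of alphabet `φ`. [folklore] -/
theorem regEnd_map {φ : α → β} (hφ : Function.Injective φ) (x : α) (w : List α) :
    regEnd (φ x) (w.map φ) = (regEnd x w).mapDomain (List.map φ) := by
  unfold regEnd
  rw [← List.map_reverse, regFront_map hφ, ← Finsupp.mapDomain_comp, ← Finsupp.mapDomain_comp]
  congr 1
  funext v
  simp [List.map_reverse]

/-- **Naturality**: `reg (φ x) (φ y) (φ_* w) = φ_* (reg x y w)` for an injective `φ`. [folklore] -/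
theorem reg_map {φ : α → β} (hφ : Function.Injective φ) (x y : α) (w : List α) :
    reg (φ x) (φ y) (w.map φ) = (reg x y w).mapDomain (List.map φ) := by
  unfold reg
  rw [regEnd_map hφ, Finsupp.sum_mapDomain_index_inj (List.map_injective_iff.mpr hφ)]
  rw [Finsupp.mapDomain_sum]
  refine Finsupp.sum_congr fun u _ => ?_
  rw [Finsupp.mapDomain_smul, regFront_map hφ]

/-! ## 2. Letter counts and lengths are preserved by the regularisation -/

omit [DecidableEq β] in
/-- Shuffles preserve letter counts: `|w|_a = |u|_a + |v|_a` for `w ∈ u ш v`. [folklore] -/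
theorem count_of_mem_shuffleWord (a : α) :
    ∀ (u v : List α) {w : List α}, w ∈ MZV.shuffleWord u v → w.count a = u.count a + v.count a
  | [], v, w, hw => by simp at hw; subst hw; simp
  | c :: u, [], w, hw => by simp at hw; subst hw; simp
  | c :: u, d :: v, w, hw => by
    rw [MZV.shuffleWord_cons_cons, List.mem_append, List.mem_map, List.mem_map] at hw
    rcases hw with ⟨w', hw', rfl⟩ | ⟨w', hw', rfl⟩
    · have ih := count_of_mem_shuffleWord a u (d :: v) hw'
      simp only [List.count_cons] at ih ⊢
      omega
    · have ih := count_of_mem_shuffleWord a (c :: u) v hw'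
      simp only [List.count_cons] at ih ⊢
      omega

/-- For `i ≤ leadCount y w`, `w = yⁱ ++ drop i w`. [folklore] -/
theorem replicate_append_drop_of_le (y : α) (w : List α) {i : ℕ} (hi : i ≤ leadCount y w) :
    List.replicate i y ++ w.drop i = w := by
  have h := replicate_leadCount_append_drop y w
  set m := leadCount y w
  conv_rhs => rw [← h]
  conv_lhs => rw [← h]
  rw [List.drop_append_of_le_length (by simpa using hi), List.drop_replicate, ← List.append_assoc,
    ← List.replicate_add, Nat.add_sub_cancel' hi]

/-- Words in the support of `regFront y w` have the letter counts of `w`. [folklore] -/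
theorem count_eq_of_mem_support_regFront (y : α) (w : List α) {u : List α}
    (hu : u ∈ (regFront y w).support) (a : α) : u.count a = w.count a := by
  obtain ⟨i, hi, hmem⟩ := exists_of_mem_support_regFront y w hu
  rw [count_of_mem_shuffleWord a _ _ hmem, ← List.count_append, replicate_append_drop_of_le y w hi]

/-- Words in the support of `regEnd x w` have the letter counts of `w`. [folklore] -/
theorem count_eq_of_mem_support_regEnd (x : α) (w : List α) {u : List α}
    (hu : u ∈ (regEnd x w).support) (a : α) : u.count a = w.count a := by
  rw [regEnd, Finsupp.mapDomain_support_of_injective List.reverse_injective, Finset.mem_image] at hu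
  obtain ⟨v, hv, rfl⟩ := hu
  rw [List.count_reverse, count_eq_of_mem_support_regFront x _ hv, List.count_reverse]

/-- **`reg` preserves letter counts**: words in the support of `reg x y w` have the letter counts
of `w` (hence its length, and its number of `y`'s = the sign `(-1)^{dp}`). [folklore] -/
theorem count_eq_of_mem_support_reg (x y : α) (w : List α) {v : List α}
    (hv : v ∈ (reg x y w).support) (a : α) : v.count a = w.count a := by
  rw [reg] at hv
  simp only [Finsupp.sum] at hv
  obtain ⟨u, hu, huv⟩ := Finset.mem_biUnion.mp (Finsupp.support_finsetSum hv)
  rw [count_eq_of_mem_support_regFront y u (Finsupp.support_smul huv),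
    count_eq_of_mem_support_regEnd x w hu]

omit [DecidableEq β] in
/-- Two words with the same letter counts have the same length. [folklore] -/
theorem length_eq_of_count_eq {v w : List α} (h : ∀ a, v.count a = w.count a) :
    v.length = w.length := by
  have hset : v.toFinset = w.toFinset := by
    ext a
    rw [List.mem_toFinset, List.mem_toFinset, ← List.count_pos_iff, ← List.count_pos_iff, h]
  rw [← List.sum_toFinset_count_eq_length, ← List.sum_toFinset_count_eq_length, hset]
  exact Finset.sum_congr rfl fun a _ => h a

/-- Words in the support of `reg x y w` have the length of `w`. [folklore] -/
theorem length_eq_of_mem_support_reg (x y : α) (w : List α) {v : List α}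
    (hv : v ∈ (reg x y w).support) : v.length = w.length :=
  length_eq_of_count_eq (count_eq_of_mem_support_reg x y w hv)

omit [DecidableEq β] [DecidableEq α] in
/-- The pairing is linear in the series: differences. [folklore] -/
theorem pair_sub {K : Type*} [AddCommGroup K] [Module ℚ K] (χ χ' : List α → K) (F : List α →₀ ℚ) :
    pair χ F - pair χ' F = pair (fun v => χ v - χ' v) F := by
  unfold pair
  rw [← Finsupp.sum_sub]
  exact Finsupp.sum_congr fun v _ => (smul_sub _ _ _).symm

omit [DecidableEq β] [DecidableEq α] in
/-- `⟨χ, g_* F⟩ = ⟨χ ∘ g, F⟩` for a change of alphabet `g : List β → List α`. [folklore] -/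
theorem pair_mapDomain₂ {K : Type*} [AddCommMonoid K] [Module ℚ K] (χ : List α → K)
    (g : List β → List α) (F : List β →₀ ℚ) : pair χ (F.mapDomain g) = pair (χ ∘ g) F := by
  simp only [pair]
  rw [Finsupp.sum_mapDomain_index (by simp) (by intros; simp [add_smul])]
  rfl

/-- The `ℓ¹`-norm of the coefficients of `reg x y w` (a combinatorial constant of the word).
[folklore] -/
def regNorm (x y : α) (w : List α) : ℝ := (reg x y w).sum fun _ a => |(a : ℝ)|

/-- `‖reg x y w‖₁ ≥ 0`. [folklore] -/
theorem regNorm_nonneg (x y : α) (w : List α) : 0 ≤ regNorm x y w :=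
  Finset.sum_nonneg fun _ _ => abs_nonneg _

omit [DecidableEq β] [DecidableEq α] in
/-- `|⟨S, F⟩| ≤ (Σ |F_v|) · sup |S|` on the support. [folklore] -/
theorem abs_pair_le {S : List α → ℝ} {F : List α →₀ ℚ} {M : ℝ} (hM : ∀ v ∈ F.support, |S v| ≤ M) :
    |pair S F| ≤ (F.sum fun _ a => |(a : ℝ)|) * M := by
  unfold pair
  simp only [Finsupp.sum, Finset.sum_mul]
  refine (Finset.abs_sum_le_sum_abs _ _).trans (Finset.sum_le_sum fun v hv => ?_)
  rw [Rat.smul_def, abs_mul]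
  exact mul_le_mul_of_nonneg_left (hM v hv) (abs_nonneg _)

end Shuffle

/-! ## 3. A KZ edge: the two singular letters plus small neutral letters -/

section Edge

variable {α : Type*} [Fintype α] [DecidableEq α] {x y : α} (hxy : x ≠ y) {f : α → ℝ → ℝ} {η : ℝ}
  (hη : 0 ≤ η)
  (hfx : ∀ t ∈ Ioo (0 : ℝ) 1, f x t = 1 / t) (hfy : ∀ t ∈ Ioo (0 : ℝ) 1, f y t = 1 / (t - 1))
  (hcont : ∀ c, ContinuousOn (f c) (Ioo 0 1))

omit [Fintype α] [DecidableEq α] in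
include hxy in
/-- The embedding `NCSeries.bsub x y : Bool → α` of the KZ alphabet (`false ↦ x = A`,
`true ↦ y = B`) is injective when `x ≠ y`. [folklore] -/
theorem bsub_injective : Function.Injective (NCSeries.bsub x y) := by
  intro a b h; cases a <;> cases b <;> simp_all [NCSeries.bsub, hxy.symm]

omit [Fintype α] [DecidableEq α] in
/-- Relabelling: `I^f_{φ_* w} = I^{f ∘ φ}_w`. [folklore] -/
theorem iterInt_map {β : Type*} (φ : β → α) (a : ℝ) : ∀ (w : List β) (b : ℝ),
    iterInt f (w.map φ) a b = iterInt (fun c => f (φ c)) w a b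
  | [], _ => rfl
  | c :: w, b => by
    rw [List.map_cons, iterInt_cons, iterInt_cons]
    exact intervalIntegral.integral_congr fun t _ => by rw [iterInt_map φ a w t]

omit [Fintype α] [DecidableEq α] in
include hfx hfy in
/-- On pure words the edge transport is the KZ transport of `DrinfeldAssociatorLimit.lean`.
[folklore] -/
theorem transportSeries_map_bsub {a b : ℝ} (ha : a ∈ Ioo (0 : ℝ) 1) (hb : b ∈ Ioo (0 : ℝ) 1)
    (v : List Bool) :
    transportSeries f a b (v.map (NCSeries.bsub x y)) = KZ3.kzTransport a b v := by
  rw [transportSeries_apply, iterInt_map, KZ3.kzTransport, transportSeries_apply]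
  refine iterInt_congr (fun c t ht => ?_) v right_mem_uIcc
  have ht' : t ∈ Ioo (0 : ℝ) 1 := (ordConnected_Ioo.uIcc_subset ha hb) ht
  cases c
  · rw [NCSeries.bsub_false, hfx t ht', KZ3.F₀_false]
  · rw [NCSeries.bsub_true, hfy t ht', KZ3.F₀_true]

omit [Fintype α] [DecidableEq α] in
include hfx in
/-- The coefficient of the single letter `x`: `S(x) = ∫_a^b dt/t = log (b/a)`. [folklore] -/
theorem transportSeries_x {a b : ℝ} (ha : a ∈ Ioo (0 : ℝ) 1) (hb : b ∈ Ioo (0 : ℝ) 1) :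
    transportSeries f a b [x] = Real.log (b / a) := by
  rw [transportSeries_apply, iterInt_cons]
  simp only [iterInt_nil, mul_one]
  rw [intervalIntegral.integral_congr (g := fun t => t⁻¹) fun t ht => ?_,
    integral_inv_of_pos ha.1 hb.1]
  rw [hfx t ((ordConnected_Ioo.uIcc_subset ha hb) ht), one_div]

omit [Fintype α] [DecidableEq α] in
include hfy in
/-- The coefficient of the single letter `y`: `S(y) = ∫_a^b dt/(t-1) = log ((1-b)/(1-a))`.
[folklore] -/
theorem transportSeries_y {a b : ℝ} (ha : a ∈ Ioo (0 : ℝ) 1) (hb : b ∈ Ioo (0 : ℝ) 1) :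
    transportSeries f a b [y] = Real.log ((1 - b) / (1 - a)) := by
  rw [transportSeries_apply, iterInt_cons]
  simp only [iterInt_nil, mul_one]
  rw [intervalIntegral.integral_congr (g := fun t => -(1 - t)⁻¹) fun t ht => ?_,
    intervalIntegral.integral_neg, intervalIntegral.integral_comp_sub_left (fun t => t⁻¹) 1,
    integral_inv_of_pos (by linarith [hb.2]) (by linarith [ha.2]), ← Real.log_inv, inv_div]
  rw [hfy t ((ordConnected_Ioo.uIcc_subset ha hb) ht), one_div, ← neg_sub, inv_neg]

omit [Fintype α] [DecidableEq α] in
include hcont in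
/-- The edge transport is group-like (Ree's shuffle relation for iterated integrals).
[folklore] -/
theorem isGroupLike_edge {a b : ℝ} (ha : a ∈ Ioo (0 : ℝ) 1) (hb : b ∈ Ioo (0 : ℝ) 1) :
    NCSeries.IsGroupLike (transportSeries f a b) :=
  isGroupLike_transportSeries isOpen_Ioo ordConnected_Ioo hcont ha hb

/-! ### `L¹` bounds and words containing a neutral letter -/

include hfx hfy hη in
omit [Fintype α] [DecidableEq α] in
/-- Each letter's `L¹` norm on `[a,b] ⊆ (0,1)` is at most `K = |log a| + |log(1-b)| + η`.
[folklore] -/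
theorem integral_abs_le_K {a b : ℝ} (ha : 0 < a) (hab : a ≤ b) (hb : b < 1)
    (hsmall : ∀ c, c ≠ x → c ≠ y → (∫ t in a..b, |f c t|) ≤ η) (c : α) :
    ∫ t in a..b, |f c t| ≤ |Real.log a| + |Real.log (1 - b)| + η := by
  have hsub : uIcc a b ⊆ Ioo (0 : ℝ) 1 :=
    ordConnected_Ioo.uIcc_subset ⟨ha, hab.trans_lt hb⟩ ⟨ha.trans_le hab, hb⟩
  by_cases hcx : c = x
  · subst hcx
    calc ∫ t in a..b, |f c t| = ∫ t in a..b, |KZ3.P false t| :=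
          intervalIntegral.integral_congr fun t ht => by rw [hfx t (hsub ht), KZ3.P_false]
      _ ≤ |Real.log a| := KZ3.integral_abs_P_false_le ha hab hb.le
      _ ≤ _ := by linarith [abs_nonneg (Real.log (1 - b))]
  by_cases hcy : c = y
  · subst hcy
    calc ∫ t in a..b, |f c t| = ∫ t in a..b, |KZ3.P true t| :=
          intervalIntegral.integral_congr fun t ht => by
            rw [hfy t (hsub ht), KZ3.P_true, one_div, one_div, ← neg_sub, inv_neg, abs_neg]
      _ ≤ |Real.log (1 - b)| := KZ3.integral_abs_P_true_le ha.le hab hb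
      _ ≤ _ := by linarith [abs_nonneg (Real.log a)]
  · calc ∫ t in a..b, |f c t| ≤ η := hsmall c hcx hcy
      _ ≤ _ := by linarith [abs_nonneg (Real.log a), abs_nonneg (Real.log (1 - b))]

omit [Fintype α] [DecidableEq α] in
/-- Product bound with one small factor. [folklore] -/
theorem list_prod_le_of_one_small {L : List α} {F : α → ℝ} {K ε : ℝ} (hK : 0 ≤ K) (hε : 0 ≤ ε)
    (h0 : ∀ c ∈ L, 0 ≤ F c) (hle : ∀ c ∈ L, F c ≤ K) {c₀ : α} (hc₀ : c₀ ∈ L) (hsmall : F c₀ ≤ ε) :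
    (L.map F).prod ≤ ε * K ^ (L.length - 1) := by
  induction L with
  | nil => simp at hc₀
  | cons c L ih =>
    rw [List.map_cons, List.prod_cons, List.length_cons, Nat.add_sub_cancel]
    have hLnn : 0 ≤ (L.map F).prod := List.prod_nonneg (by
      intro z hz; obtain ⟨j, hj, rfl⟩ := List.mem_map.mp hz; exact h0 j (by simp [hj]))
    have hLK : (L.map F).prod ≤ K ^ L.length := by
      calc (L.map F).prod ≤ (L.map fun _ => K).prod :=
            list_prod_map_le_prod_map L (fun j hj => h0 j (by simp [hj])) fun j hj =>
              hle j (by simp [hj])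
        _ = K ^ L.length := by rw [List.map_const', List.prod_replicate]
    rcases List.mem_cons.mp hc₀ with rfl | hmem
    · exact mul_le_mul hsmall hLK hLnn hε
    · have ih' := ih (fun j hj => h0 j (by simp [hj])) (fun j hj => hle j (by simp [hj])) hmem
      have hlen : 1 ≤ L.length := List.length_pos_iff.mpr (List.ne_nil_of_mem hmem)
      calc F c * (L.map F).prod ≤ K * (ε * K ^ (L.length - 1)) :=
            mul_le_mul (hle c (by simp)) ih' hLnn hK
        _ = ε * K ^ L.length := by
            rw [← mul_assoc, mul_comm K ε, mul_assoc, ← pow_succ', Nat.sub_add_cancel hlen]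

include hfx hfy hcont hη in
omit [Fintype α] [DecidableEq α] in
/-- **Words containing a neutral letter are small**: `|S(V)| ≤ η K^{|V|-1}`. [folklore] -/
theorem abs_transport_le_of_neutral {a b : ℝ} (ha : 0 < a) (hab : a ≤ b) (hb : b < 1)
    (hsmall : ∀ c, c ≠ x → c ≠ y → (∫ t in a..b, |f c t|) ≤ η) {V : List α}
    {c₀ : α} (hc₀ : c₀ ∈ V) (hcx : c₀ ≠ x) (hcy : c₀ ≠ y) :
    |transportSeries f a b V| ≤ η * (|Real.log a| + |Real.log (1 - b)| + η) ^ (V.length - 1) := by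
  have ha' : a ∈ Ioo (0 : ℝ) 1 := ⟨ha, hab.trans_lt hb⟩
  have hb' : b ∈ Ioo (0 : ℝ) 1 := ⟨ha.trans_le hab, hb⟩
  refine (abs_iterInt_le_prod isOpen_Ioo ordConnected_Ioo hcont ha' V hb' hab).trans ?_
  exact list_prod_le_of_one_small (by positivity) hη
    (fun c _ => intervalIntegral.integral_nonneg hab fun t _ => abs_nonneg _)
    (fun c _ => integral_abs_le_K hη hfx hfy ha hab hb hsmall c) hc₀
    (hsmall c₀ hcx hcy)

/-! ### The regularised transport `R(W) = ⟨S, reg x y W⟩` and its distance to `Φ_KZ` -/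

omit [Fintype α] in
include hxy hfx hfy in
/-- **Pure words**: `|R(ι_* w) - Φ_KZ(w)| ≤ ‖reg w‖₁ (|w|+1)² 16^{|w|} ρ_{|w|}(a, b)`.
[cite: Furusho2003, §3.2 (Φ_KZ as regularised holonomy from 0 to 1)] -/
theorem abs_pair_reg_map_sub_drinfeldAssociator_le {a b : ℝ} (ha0 : 0 < a) (ha : a < 1 / 2)
    (hb1 : 1 / 2 < b) (hb : b < 1) (w : List Bool) :
    |Shuffle.pair (transportSeries f a b) (Shuffle.reg x y (w.map (NCSeries.bsub x y))) -
        drinfeldAssociator w| ≤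
      Shuffle.regNorm false true w *
        ((w.length + 1) ^ 2 * 16 ^ w.length * KZ3.rate w.length a b) := by
  have ha' : a ∈ Ioo (0 : ℝ) 1 := ⟨ha0, by linarith⟩
  have hb' : b ∈ Ioo (0 : ℝ) 1 := ⟨by linarith, hb⟩
  have hι : Function.Injective (NCSeries.bsub x y) := bsub_injective hxy
  have hreg : Shuffle.reg x y (w.map (NCSeries.bsub x y)) =
      (Shuffle.reg false true w).mapDomain (List.map (NCSeries.bsub x y)) :=
    Shuffle.reg_map hι false true w
  have hpm : Shuffle.pair (transportSeries f a b)
      ((Shuffle.reg false true w).mapDomain (List.map (NCSeries.bsub x y))) =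
      Shuffle.pair (transportSeries f a b ∘ List.map (NCSeries.bsub x y))
        (Shuffle.reg false true w) :=
    Shuffle.pair_mapDomain₂ (transportSeries f a b) (List.map (NCSeries.bsub x y))
      (Shuffle.reg false true w)
  -- both sides as pairings against `reg false true w = MZV.shuffleReg w`
  have hΦ : drinfeldAssociator w = Shuffle.pair (fun v => (-1 : ℝ) ^ (w.count true) *
      multipleZeta (MZV.ofBinaryWord v)) (Shuffle.reg false true w) := by
    rw [drinfeldAssociator_apply, MZV.zetaWordSum, Shuffle.reg_false_true_eq_shuffleReg,
      Shuffle.pair,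
      Finsupp.mul_sum]
    refine Finsupp.sum_congr fun v _ => ?_
    simp only [Rat.smul_def]; ring
  have hS : Shuffle.pair (transportSeries f a b ∘ List.map (NCSeries.bsub x y))
      (Shuffle.reg false true w) =
      Shuffle.pair (fun v => (-1 : ℝ) ^ (w.count true) * iterInt KZ3.P v a b)
        (Shuffle.reg false true w) := by
    refine Shuffle.pair_congr fun v hv => ?_
    rw [Function.comp_apply, transportSeries_map_bsub hfx hfy ha' hb', KZ3.kzTransport_apply,
      Shuffle.count_eq_of_mem_support_reg false true w hv]
  rw [hreg, hpm, hΦ, hS, Shuffle.pair_sub]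
  unfold Shuffle.regNorm
  refine Shuffle.abs_pair_le fun v hv => ?_
  rw [← mul_sub, abs_mul, abs_pow, abs_neg, abs_one, one_pow, one_mul]
  have hconv : KZ3.IsConvWord v := by
    obtain ⟨h1, h2⟩ := Shuffle.support_reg_subset (by decide : false ≠ true) w hv
    refine ⟨?_, ?_⟩
    · rcases hh : v.head? with _ | c
      · left; exact List.head?_eq_none_iff.mp hh
      · cases c
        · right; exact hh
        · exact absurd hh h1
    · rcases hh : v.getLast? with _ | c
      · left; exact List.getLast?_eq_none_iff.mp hh
      · cases c
        · exact absurd hh h2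
        · right; exact hh
  have hlen : v.length = w.length := Shuffle.length_eq_of_mem_support_reg false true w hv
  rw [← hlen]
  exact KZ3.abs_iterInt_sub_multipleZeta_le hconv ha0 ha hb1 hb

include hfx hfy hcont hη in
omit [Fintype α] in
/-- **Words with a neutral letter**: `|R(W)| ≤ ‖reg W‖₁ η K^{|W|-1}`. [folklore] -/
theorem abs_pair_reg_le_of_neutral {a b : ℝ} (ha : 0 < a) (hab : a ≤ b) (hb : b < 1)
    (hsmall : ∀ c, c ≠ x → c ≠ y → (∫ t in a..b, |f c t|) ≤ η) {W : List α}
    {c₀ : α} (hc₀ : c₀ ∈ W) (hcx : c₀ ≠ x) (hcy : c₀ ≠ y) :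
    |Shuffle.pair (transportSeries f a b) (Shuffle.reg x y W)| ≤
      Shuffle.regNorm x y W * (η * (|Real.log a| + |Real.log (1 - b)| + η) ^ (W.length - 1)) := by
  refine Shuffle.abs_pair_le fun V hV => ?_
  have hcount := Shuffle.count_eq_of_mem_support_reg x y W hV c₀
  have hmem : c₀ ∈ V := List.count_pos_iff.mp (by rw [hcount]; exact List.count_pos_iff.mpr hc₀)
  rw [← Shuffle.length_eq_of_mem_support_reg x y W hV]
  exact abs_transport_le_of_neutral hη hfx hfy hcont ha hab hb hsmall hmem hcx hcy

omit [Fintype α] in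
include hxy hcont in
/-- **The factorisation on the edge**: `exp(-S(y) y) · S · exp(-S(x) x) = Σ_W R(W) W`.
[cite: IharaKanekoZagier2006, Prop. 1 & (5.3)] -/
theorem edge_factorisation {a b : ℝ} (ha : a ∈ Ioo (0 : ℝ) 1) (hb : b ∈ Ioo (0 : ℝ) 1) :
    Shuffle.expLetter y (-transportSeries f a b [y]) * transportSeries f a b *
        Shuffle.expLetter x (-transportSeries f a b [x]) =
      fun W => Shuffle.pair (transportSeries f a b) (Shuffle.reg x y W) := by
  ext W
  exact Shuffle.factorisation (isGroupLike_edge hcont ha hb) hxy W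

end Edge

end Literature.NumberTheory.Transcendental
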